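import Literature.Analysis.Calculus.PeriodicMollifier
import HarnessLib

/-!
# Uniform approximation of continuous maps by smooth maps, respecting translation symmetries

Topic `Analysis/Calculus`; namespace `Literature.Analysis.Calculus`.  Theorems only; no named
fact, no `sorry`.  The `C⁰` companion of `exists_contDiff_approx_fderiv` (`PeriodicMollifier.lean`,
which treats `C¹` maps in the `C¹` topology):

* `exists_contDiff_approx_of_continuous` — for `f : E → F` continuous (`E` finite dimensional,
  `F` complete), `K ⊆ E` compact and `ε > 0`, there is a `C^∞` map `g` with `‖g x - f x‖ ≤ ε` on
  `K` having every translation symmetry of `f` (`g = φ ⋆ f` for a normalised bump `φ` of radius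
  below the `ε`-uniform-continuity modulus of `f` on the `1`-thickening of `K`; Evans, *PDE*,
  App. C.4 Thm. 7 (iii));
* `exists_contDiff_periodic_approx` — a continuous `T`-periodic `f : ℝ → F` is, for every
  `ε > 0`, uniformly `ε`-close on all of `ℝ` to a `C^∞` `T`-periodic map.

Used in `Literature/Geometry/Symplectic` to replace the continuous minority section of an even
zero circle of a near-symplectic form by a smooth one (Perutz 2006, Prop. 2.2 / §3).

## References

* L. C. Evans, *Partial Differential Equations*, 2nd ed. (2010), App. C.4 Thm. 7. [Evans2010]
* M. W. Hirsch, *Differential Topology*, GTM 33 (1976), Ch. 2, Thm. 2.6. [HirschDT1976]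
-/

noncomputable section

open MeasureTheory Set Function Metric Filter
open scoped Convolution ContDiff Topology

namespace Literature.Analysis.Calculus

variable {E : Type*} [NormedAddCommGroup E] [NormedSpace ℝ E] [FiniteDimensional ℝ E]
  {F : Type*} [NormedAddCommGroup F] [NormedSpace ℝ F] [CompleteSpace F]

/-- **`C⁰` approximation by smooth maps on compact sets, respecting translation symmetries.**
If `f : E → F` is continuous (`E` finite dimensional, `F` complete), `K ⊆ E` is compact and
`ε > 0`, there is a `C^∞` map `g : E → F` with `‖g x - f x‖ ≤ ε` for all `x ∈ K` and
`g (x + v) = g x` for all `x` whenever `f (x + v) = f x` for all `x` (mollification by a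
normalised bump of small radius). [cite: Evans2010, App. C.4 Thm. 7] -/
theorem exists_contDiff_approx_of_continuous {f : E → F} (hf : Continuous f) {K : Set E}
    (hK : IsCompact K) {ε : ℝ} (hε : 0 < ε) :
    ∃ g : E → F, ContDiff ℝ ∞ g ∧
      (∀ v : E, (∀ x, f (x + v) = f x) → ∀ x, g (x + v) = g x) ∧
      ∀ x ∈ K, ‖g x - f x‖ ≤ ε := by
  borelize E
  set μ : Measure E := Measure.addHaar
  have hK' : IsCompact (cthickening 1 K) := hK.cthickening
  obtain ⟨δ₁, hδ₁, hδ₁f⟩ := Metric.uniformContinuousOn_iff.mp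
    (hK'.uniformContinuousOn_of_continuous hf.continuousOn) ε hε
  set δ' : ℝ := min δ₁ 1 with hδ'
  have hδ'pos : 0 < δ' := lt_min hδ₁ one_pos
  have hδ'1 : δ' ≤ 1 := min_le_right _ _
  have hδ'δ₁ : δ' ≤ δ₁ := min_le_left _ _
  let φ : ContDiffBump (0 : E) := ⟨δ' / 4, δ' / 2, by positivity, by linarith⟩
  refine ⟨φ.normed μ ⋆[ContinuousLinearMap.lsmul ℝ ℝ, μ] f, ?_, ?_, ?_⟩
  · exact φ.hasCompactSupport_normed.contDiff_convolution_left _ φ.contDiff_normed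
      hf.locallyIntegrable
  · intro v hv x
    exact normed_convolution_add_of_forall_add φ μ hv x
  · intro x hx
    rw [← dist_eq_norm]
    apply ContDiffBump.dist_normed_convolution_le hf.aestronglyMeasurable
    intro y hy
    have hyx : dist y x < δ' / 2 := hy
    have hy' : y ∈ cthickening 1 K :=
      Metric.mem_cthickening_of_dist_le y x 1 K hx (by linarith)
    exact (hδ₁f y hy' x (self_subset_cthickening K hx) (by linarith)).le

/-- Iterating a translation symmetry over the integers: `f (x + k • v) = f x`. [folklore] -/
theorem apply_add_zsmul_of_forall {α β : Type*} [AddCommGroup α] {f : α → β} {v : α}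
    (hv : ∀ x, f (x + v) = f x) (x : α) (k : ℤ) : f (x + k • v) = f x :=
  (show Function.Periodic f v from hv).zsmul k x

/-- **Continuous periodic maps are uniformly approximable by smooth periodic maps**: for
`f : ℝ → F` continuous and `T`-periodic (`T > 0`) and `ε > 0` there is a `C^∞` `T`-periodic
`g : ℝ → F` with `‖g x - f x‖ ≤ ε` for ALL `x` (approximate on the compact period `[0, T]`, then
use periodicity of both maps). [cite: Evans2010, App. C.4 Thm. 7] -/
theorem exists_contDiff_periodic_approx {f : ℝ → F} (hf : Continuous f) {T : ℝ} (hT : 0 < T)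
    (hper : ∀ x, f (x + T) = f x) {ε : ℝ} (hε : 0 < ε) :
    ∃ g : ℝ → F, ContDiff ℝ ∞ g ∧ (∀ x, g (x + T) = g x) ∧ ∀ x, ‖g x - f x‖ ≤ ε := by
  obtain ⟨g, hg, hsym, hclose⟩ :=
    exists_contDiff_approx_of_continuous hf (isCompact_Icc : IsCompact (Icc (0 : ℝ) T)) hε
  have hgper : ∀ x, g (x + T) = g x := hsym T hper
  refine ⟨g, hg, hgper, fun x ↦ ?_⟩
  set x' : ℝ := toIcoMod hT 0 x with hx'
  set k : ℤ := toIcoDiv hT 0 x with hk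
  have hxx : x' + k • T = x := toIcoMod_add_toIcoDiv_zsmul hT 0 x
  have hx'I : x' ∈ Icc (0 : ℝ) T := by
    have h := toIcoMod_mem_Ico hT 0 x
    rw [zero_add] at h
    exact ⟨h.1, h.2.le⟩
  have hgx : g x = g x' := by rw [← hxx, apply_add_zsmul_of_forall hgper]
  have hfx : f x = f x' := by rw [← hxx, apply_add_zsmul_of_forall hper]
  rw [hgx, hfx]
  exact hclose x' hx'I

end Literature.Analysis.Calculus

end
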